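import Mathlib
import HarnessLib
import Literature.NumberTheory.LFunctions.RobertSargosTaylorBox
import Literature.NumberTheory.LFunctions.RobertSargosPartialSummation

/-!
# Robert–Sargos 2002, Step 4: removing `e(u_{m,r})` by partial summation — PROVED

Topic `Literature/NumberTheory/LFunctions`. Everything here is PROVED (no `sorry`, no named facts).
Step 4 of the proof of Theorem 1 of O. Robert, P. Sargos, *A fourth derivative test for exponential
sums*, Compositio Math. 130 (2002) 275–292 (= arXiv:2307.03562v1): after the Taylor expansion (4·16),
"the upper bound `f⁽⁴⁾(x) ≪ λ` and the size of `Q`, `N` and `H₁` show that the function `u_{m,r}(q,h,n)`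
satisfies hypothesis (2·3) of Lemma 2, with `D ≪ 1`. This lemma shows that in the right member of
(4·11) one may take off the factor `(1 - |q|/Q) e(u_{m,r}(q,h,n))`."

`RobertSargos.step4_partialSummation`: for a derivative family `D` of order `4` with `|D 4| ≤ Λ` on
`[a, b]`, a fixed `r`, a sign `s = ±1` for `q = s(q'+1)`, `h = H₀ + h'`, `n = n' + 1`
(`q' < A`, `h' < B`, `n' < C`), a finite set `J` of integers `m` with `[m - Y, m + Y] ⊆ [a, b]` where
`A + B + C + H₀ + |r| + 6 ≤ Y`, and ARBITRARY coefficients `c_m(q', h', n')`,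

  `∑_{m ∈ J} |∑_{q',h',n'} c_m(q',h',n') e(u_{m,r}(q,h,n))| ≤ 8 D_u ∑_{m ∈ J} |∑_{q'<A'} ∑_{h'<B'} ∑_{n'<C'} c_m|`

for some corner sub-box `A' ≤ A, B' ≤ B, C' ≤ C`, with `D_u = 1 + 7K + 200K² + 250K³`, `K = 4ΛY⁴`
(so `D_u ≪ 1` when `λY⁴ ≪ 1`, the printed "size of `Q, N, H₁`"). This is Lemma 2
(`RobertSargos.partialSummation₃`, in the tree) applied with `φ_m = e(u_{m,r})`, whose mixed unit
differences are controlled by `RobertSargos.uPert_diff_bounds` and the tree's `norm_diff₂_e_le`,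
`norm_diff₃_e_le`; the weight `(1 - |q|/Q)` is simply kept inside `c_m`.

## References

* O. Robert, P. Sargos, *A fourth derivative test for exponential sums*, Compositio Math. 130 (2002),
  275–292, doi:10.1023/A:1014363224308 = arXiv:2307.03562v1 — §4 Step 4, Lemma 2. [RobertSargos2002]
-/

noncomputable section

open Finset Set

namespace Literature.NumberTheory.LFunctions
namespace RobertSargos

open Literature.NumberTheory.LFunctions.VdC (e norm_e e_add DerivFamily)

/-- Numerical bounds on `π` used for the constant `D_u`. [folklore] -/
theorem pi_bounds : 2 * Real.pi ≤ 7 ∧ 4 * Real.pi ^ 2 ≤ 40 ∧ 8 * Real.pi ^ 3 ≤ 250 := by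
  have h1 := Real.pi_lt_d4
  have h0 := Real.pi_pos
  refine ⟨by linarith, by nlinarith, by nlinarith [mul_pos h0 h0]⟩

/-- The perturbation in the box coordinates of Lemma 2: `q = s(q'+1)`, `h = H₀ + h'`, `n = n'+1`.
[cite: RobertSargos2002, Step 4] -/
def Ubox (D : ℕ → ℝ → ℝ) (m : ℝ) (r s H₀ : ℤ) (q' h' n' : ℕ) : ℝ :=
  uPert D m r ((s : ℝ) * ((q' : ℝ) + 1)) ((H₀ : ℝ) + h') ((n' : ℝ) + 1)

/-- The seven mixed unit differences of `Ubox` (both signs `s = ±1`), from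
`RobertSargos.uPert_diff_bounds`. [cite: RobertSargos2002, Step 4] -/
theorem Ubox_bounds {D : ℕ → ℝ → ℝ} {a b Λ : ℝ} (hD : DerivFamily D a b 4)
    (hΛ : ∀ t ∈ Icc a b, |D 4 t| ≤ Λ) {m Y : ℝ} (hY : 0 ≤ Y) (hmY : Icc (m - Y) (m + Y) ⊆ Icc a b)
    {r s H₀ : ℤ} (hs : s = 1 ∨ s = -1) (hH₀ : 0 ≤ H₀) {q' h' n' : ℕ}
    (hbig : (q' : ℝ) + h' + n' + H₀ + |(r : ℝ)| + 7 ≤ Y) :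
    |Ubox D m r s H₀ (q' + 1) h' n' - Ubox D m r s H₀ q' h' n'| ≤ 4 * Λ * Y ^ 3 ∧
    |Ubox D m r s H₀ q' (h' + 1) n' - Ubox D m r s H₀ q' h' n'| ≤ 4 * Λ * Y ^ 3 ∧
    |Ubox D m r s H₀ q' h' (n' + 1) - Ubox D m r s H₀ q' h' n'| ≤ 4 * Λ * Y ^ 3 ∧
    |Ubox D m r s H₀ (q' + 1) (h' + 1) n' - Ubox D m r s H₀ (q' + 1) h' n' -
        Ubox D m r s H₀ q' (h' + 1) n' + Ubox D m r s H₀ q' h' n'| ≤ 4 * Λ * Y ^ 2 ∧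
    |Ubox D m r s H₀ (q' + 1) h' (n' + 1) - Ubox D m r s H₀ q' h' (n' + 1) -
        Ubox D m r s H₀ (q' + 1) h' n' + Ubox D m r s H₀ q' h' n'| ≤ 4 * Λ * Y ^ 2 ∧
    |Ubox D m r s H₀ q' (h' + 1) (n' + 1) - Ubox D m r s H₀ q' h' (n' + 1) -
        Ubox D m r s H₀ q' (h' + 1) n' + Ubox D m r s H₀ q' h' n'| ≤ 4 * Λ * Y ^ 2 ∧
    |(Ubox D m r s H₀ (q' + 1) (h' + 1) (n' + 1) - Ubox D m r s H₀ (q' + 1) h' (n' + 1) -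
          Ubox D m r s H₀ q' (h' + 1) (n' + 1) + Ubox D m r s H₀ q' h' (n' + 1)) -
        (Ubox D m r s H₀ (q' + 1) (h' + 1) n' - Ubox D m r s H₀ (q' + 1) h' n' -
          Ubox D m r s H₀ q' (h' + 1) n' + Ubox D m r s H₀ q' h' n')| ≤ 2 * Λ * Y := by
  have hq0 : (0 : ℝ) ≤ q' := by positivity
  have hh0 : (0 : ℝ) ≤ h' := by positivity
  have hn0 : (0 : ℝ) ≤ n' := by positivity
  have hH0 : (0 : ℝ) ≤ H₀ := by exact_mod_cast hH₀
  have hr0 := abs_nonneg (r : ℝ)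
  set hh : ℝ := (H₀ : ℝ) + h' with hhh
  set nn : ℝ := (n' : ℝ) + 1 with hnn
  -- size conditions at a base point `(qq, hh, nn)` with `|qq| ≤ q' + 2`
  have sizes : ∀ qq : ℝ, |qq| ≤ q' + 2 →
      |nn + qq + hh| ≤ Y - 4 ∧ |nn + qq - hh| ≤ Y - 4 ∧ |nn + hh + r| ≤ Y - 4 ∧ |nn - hh - r| ≤ Y - 4 := by
    intro qq hqq
    have h1 := abs_le.mp hqq
    have h2 := abs_le.mp (le_refl |(r : ℝ)|)
    refine ⟨?_, ?_, ?_, ?_⟩ <;> rw [abs_le] <;> constructor <;> linarith [h1.1, h1.2, h2.1, h2.2]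
  rcases hs with rfl | rfl
  · -- `s = 1`: base point `qq = q' + 1`
    set qq : ℝ := (q' : ℝ) + 1 with hqq
    obtain ⟨s1, s2, s3, s4⟩ := sizes qq (by rw [hqq, abs_of_nonneg (by linarith)]; linarith)
    obtain ⟨d1, d2, d3, d12, d13, d23, d123⟩ := uPert_diff_bounds hD hΛ hY hmY s1 s2 s3 s4
    have e000 : Ubox D m r 1 H₀ q' h' n' = uPert D m r qq hh nn := by
      simp only [Ubox, hqq, hhh, hnn]; push_cast; ring_nf
    have e100 : Ubox D m r 1 H₀ (q' + 1) h' n' = uPert D m r (qq + 1) hh nn := by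
      simp only [Ubox, hqq, hhh, hnn]; push_cast; ring_nf
    have e010 : Ubox D m r 1 H₀ q' (h' + 1) n' = uPert D m r qq (hh + 1) nn := by
      simp only [Ubox, hqq, hhh, hnn]; push_cast; ring_nf
    have e001 : Ubox D m r 1 H₀ q' h' (n' + 1) = uPert D m r qq hh (nn + 1) := by
      simp only [Ubox, hqq, hhh, hnn]; push_cast; ring_nf
    have e110 : Ubox D m r 1 H₀ (q' + 1) (h' + 1) n' = uPert D m r (qq + 1) (hh + 1) nn := by
      simp only [Ubox, hqq, hhh, hnn]; push_cast; ring_nf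
    have e101 : Ubox D m r 1 H₀ (q' + 1) h' (n' + 1) = uPert D m r (qq + 1) hh (nn + 1) := by
      simp only [Ubox, hqq, hhh, hnn]; push_cast; ring_nf
    have e011 : Ubox D m r 1 H₀ q' (h' + 1) (n' + 1) = uPert D m r qq (hh + 1) (nn + 1) := by
      simp only [Ubox, hqq, hhh, hnn]; push_cast; ring_nf
    have e111 : Ubox D m r 1 H₀ (q' + 1) (h' + 1) (n' + 1) = uPert D m r (qq + 1) (hh + 1) (nn + 1) := by
      simp only [Ubox, hqq, hhh, hnn]; push_cast; ring_nf
    rw [e000, e100, e010, e001, e110, e101, e011, e111]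
    exact ⟨d1, d2, d3, d12, d13, d23, d123⟩
  · -- `s = -1`: base points `qb = -(q'+2)` (the corner `q'+1`) and `qb + 1` (the corner `q'`)
    set qb : ℝ := -((q' : ℝ) + 2) with hqb
    obtain ⟨s1, s2, s3, s4⟩ := sizes qb (by rw [hqb, abs_neg, abs_of_nonneg (by linarith)])
    obtain ⟨t1, t2, t3, t4⟩ := sizes (qb + 1) (by
      rw [hqb, show -((q' : ℝ) + 2) + 1 = -((q' : ℝ) + 1) by ring, abs_neg, abs_of_nonneg (by linarith)]
      linarith)
    obtain ⟨d1, d2, d3, d12, d13, d23, d123⟩ := uPert_diff_bounds hD hΛ hY hmY s1 s2 s3 s4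
    obtain ⟨f1, f2, f3, f12, f13, f23, f123⟩ := uPert_diff_bounds hD hΛ hY hmY t1 t2 t3 t4
    have e000 : Ubox D m r (-1) H₀ q' h' n' = uPert D m r (qb + 1) hh nn := by
      simp only [Ubox, hqb, hhh, hnn]; push_cast; ring_nf
    have e100 : Ubox D m r (-1) H₀ (q' + 1) h' n' = uPert D m r qb hh nn := by
      simp only [Ubox, hqb, hhh, hnn]; push_cast; ring_nf
    have e010 : Ubox D m r (-1) H₀ q' (h' + 1) n' = uPert D m r (qb + 1) (hh + 1) nn := by
      simp only [Ubox, hqb, hhh, hnn]; push_cast; ring_nf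
    have e001 : Ubox D m r (-1) H₀ q' h' (n' + 1) = uPert D m r (qb + 1) hh (nn + 1) := by
      simp only [Ubox, hqb, hhh, hnn]; push_cast; ring_nf
    have e110 : Ubox D m r (-1) H₀ (q' + 1) (h' + 1) n' = uPert D m r qb (hh + 1) nn := by
      simp only [Ubox, hqb, hhh, hnn]; push_cast; ring_nf
    have e101 : Ubox D m r (-1) H₀ (q' + 1) h' (n' + 1) = uPert D m r qb hh (nn + 1) := by
      simp only [Ubox, hqb, hhh, hnn]; push_cast; ring_nf
    have e011 : Ubox D m r (-1) H₀ q' (h' + 1) (n' + 1) = uPert D m r (qb + 1) (hh + 1) (nn + 1) := by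
      simp only [Ubox, hqb, hhh, hnn]; push_cast; ring_nf
    have e111 : Ubox D m r (-1) H₀ (q' + 1) (h' + 1) (n' + 1) = uPert D m r qb (hh + 1) (nn + 1) := by
      simp only [Ubox, hqb, hhh, hnn]; push_cast; ring_nf
    rw [e000, e100, e010, e001, e110, e101, e011, e111]
    refine ⟨?_, f2, f3, ?_, ?_, f23, ?_⟩
    · rw [abs_sub_comm]; exact d1
    · have : uPert D m r qb (hh + 1) nn - uPert D m r qb hh nn - uPert D m r (qb + 1) (hh + 1) nn +
          uPert D m r (qb + 1) hh nn = -(uPert D m r (qb + 1) (hh + 1) nn - uPert D m r (qb + 1) hh nn -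
          uPert D m r qb (hh + 1) nn + uPert D m r qb hh nn) := by ring
      rw [this, abs_neg]; exact d12
    · have : uPert D m r qb hh (nn + 1) - uPert D m r (qb + 1) hh (nn + 1) - uPert D m r qb hh nn +
          uPert D m r (qb + 1) hh nn = -(uPert D m r (qb + 1) hh (nn + 1) - uPert D m r qb hh (nn + 1) -
          uPert D m r (qb + 1) hh nn + uPert D m r qb hh nn) := by ring
      rw [this, abs_neg]; exact d13
    · have : uPert D m r qb (hh + 1) (nn + 1) - uPert D m r qb hh (nn + 1) - uPert D m r (qb + 1) (hh + 1) (nn + 1) +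
            uPert D m r (qb + 1) hh (nn + 1) -
          (uPert D m r qb (hh + 1) nn - uPert D m r qb hh nn - uPert D m r (qb + 1) (hh + 1) nn +
            uPert D m r (qb + 1) hh nn) =
          -((uPert D m r (qb + 1) (hh + 1) (nn + 1) - uPert D m r (qb + 1) hh (nn + 1) -
            uPert D m r qb (hh + 1) (nn + 1) + uPert D m r qb hh (nn + 1)) -
          (uPert D m r (qb + 1) (hh + 1) nn - uPert D m r (qb + 1) hh nn - uPert D m r qb (hh + 1) nn +
            uPert D m r qb hh nn)) := by ring
      rw [this, abs_neg]; exact d123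

set_option maxHeartbeats 400000 in
/-- **Step 4 of [RS]: the factor `e(u_{m,r}(q,h,n))` is removed by Lemma 2.** See the module
docstring. [cite: RobertSargos2002, Step 4] -/
theorem step4_partialSummation {D : ℕ → ℝ → ℝ} {a b Λ : ℝ} (hD : DerivFamily D a b 4)
    (hΛ : ∀ t ∈ Icc a b, |D 4 t| ≤ Λ) (hΛ0 : 0 ≤ Λ) (r s H₀ : ℤ) (hs : s = 1 ∨ s = -1) (hH₀ : 0 ≤ H₀)
    (A B C : ℕ) {Y : ℝ} (hYbig : (A : ℝ) + B + C + H₀ + |(r : ℝ)| + 7 ≤ Y)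
    (J : Finset ℤ) (hJ : ∀ m ∈ J, Icc ((m : ℝ) - Y) (m + Y) ⊆ Icc a b) (c : ℤ → ℕ → ℕ → ℕ → ℂ) :
    ∃ A' B' C' : ℕ, A' ≤ A ∧ B' ≤ B ∧ C' ≤ C ∧
      ∑ m ∈ J, ‖∑ q' ∈ range A, ∑ h' ∈ range B, ∑ n' ∈ range C,
          c m q' h' n' * e (Ubox D m r s H₀ q' h' n')‖ ≤
        8 * (1 + 7 * (4 * Λ * Y ^ 4) + 200 * (4 * Λ * Y ^ 4) ^ 2 + 250 * (4 * Λ * Y ^ 4) ^ 3) *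
          ∑ m ∈ J, ‖∑ q' ∈ range A', ∑ h' ∈ range B', ∑ n' ∈ range C', c m q' h' n'‖ := by
  classical
  set K : ℝ := 4 * Λ * Y ^ 4 with hK
  set Du : ℝ := 1 + 7 * K + 200 * K ^ 2 + 250 * K ^ 3 with hDu
  have hY4 : 4 ≤ Y := by
    have : (0 : ℝ) ≤ A := by positivity
    have : (0 : ℝ) ≤ B := by positivity
    have : (0 : ℝ) ≤ C := by positivity
    have : (0 : ℝ) ≤ H₀ := by exact_mod_cast hH₀
    have := abs_nonneg (r : ℝ)
    linarith
  have hY0 : 0 ≤ Y := by linarith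
  have hY1 : 1 ≤ Y := by linarith
  have hK0 : 0 ≤ K := by positivity
  have hK2 : 0 ≤ K ^ 2 := sq_nonneg K
  have hK3 : 0 ≤ K ^ 3 := pow_nonneg hK0 3
  have hDu1 : 1 ≤ Du := by rw [hDu]; linarith
  have hDu0 : 0 ≤ Du := by linarith
  obtain ⟨pi1, pi2, pi3⟩ := pi_bounds
  have piK1 : 2 * Real.pi * K ≤ 7 * K := mul_le_mul_of_nonneg_right pi1 hK0
  have piK2 : 4 * Real.pi ^ 2 * K ^ 2 ≤ 40 * K ^ 2 := mul_le_mul_of_nonneg_right pi2 hK2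
  have piK3 : 8 * Real.pi ^ 3 * K ^ 3 ≤ 250 * K ^ 3 := mul_le_mul_of_nonneg_right pi3 hK3
  have hpi := Real.pi_pos
  have hYpos : 0 < Y := by linarith
  -- the sizes `δ₁ = 4ΛY³ = K/Y`, `δ₂ = 4ΛY² = K/Y²`, `δ₃ = 2ΛY = K/(2Y³)`
  have hδ₁ : 4 * Λ * Y ^ 3 = K / Y := by rw [hK, eq_div_iff hYpos.ne']; ring
  have hδ₂ : 4 * Λ * Y ^ 2 = K / Y ^ 2 := by rw [hK, eq_div_iff (by positivity)]; ring
  have hδ₃ : 2 * Λ * Y = K / (2 * Y ^ 3) := by rw [hK, eq_div_iff (by positivity)]; ring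
  -- the maximal corner sub-box
  obtain ⟨F, hF⟩ : ∃ F : ℕ × ℕ × ℕ → ℝ, ∀ t, F t = ∑ m ∈ J, ‖∑ q' ∈ range t.1, ∑ h' ∈ range t.2.1,
    ∑ n' ∈ range t.2.2, c m q' h' n'‖ := ⟨_, fun _ => rfl⟩
  obtain ⟨t₀, ht₀, hmax⟩ := Finset.exists_max_image (range (A + 1) ×ˢ range (B + 1) ×ˢ range (C + 1)) F
    ⟨(0, 0, 0), by simp⟩
  simp only [Finset.mem_product, Finset.mem_range] at ht₀
  refine ⟨t₀.1, t₀.2.1, t₀.2.2, by omega, by omega, by omega, ?_⟩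
  -- bounds at the box points
  have hb : ∀ m ∈ J, ∀ q' h' n' : ℕ, q' < A → h' < B → n' + 1 ≤ C →
      |Ubox D m r s H₀ (q' + 1) h' n' - Ubox D m r s H₀ q' h' n'| ≤ K / Y ∧
      |Ubox D m r s H₀ q' (h' + 1) n' - Ubox D m r s H₀ q' h' n'| ≤ K / Y ∧
      |Ubox D m r s H₀ q' h' (n' + 1) - Ubox D m r s H₀ q' h' n'| ≤ K / Y ∧
      |Ubox D m r s H₀ (q' + 1) (h' + 1) n' - Ubox D m r s H₀ (q' + 1) h' n' -
          Ubox D m r s H₀ q' (h' + 1) n' + Ubox D m r s H₀ q' h' n'| ≤ K / Y ^ 2 ∧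
      |Ubox D m r s H₀ (q' + 1) h' (n' + 1) - Ubox D m r s H₀ q' h' (n' + 1) -
          Ubox D m r s H₀ (q' + 1) h' n' + Ubox D m r s H₀ q' h' n'| ≤ K / Y ^ 2 ∧
      |Ubox D m r s H₀ q' (h' + 1) (n' + 1) - Ubox D m r s H₀ q' h' (n' + 1) -
          Ubox D m r s H₀ q' (h' + 1) n' + Ubox D m r s H₀ q' h' n'| ≤ K / Y ^ 2 ∧
      |(Ubox D m r s H₀ (q' + 1) (h' + 1) (n' + 1) - Ubox D m r s H₀ (q' + 1) h' (n' + 1) -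
            Ubox D m r s H₀ q' (h' + 1) (n' + 1) + Ubox D m r s H₀ q' h' (n' + 1)) -
          (Ubox D m r s H₀ (q' + 1) (h' + 1) n' - Ubox D m r s H₀ (q' + 1) h' n' -
            Ubox D m r s H₀ q' (h' + 1) n' + Ubox D m r s H₀ q' h' n')| ≤ K / (2 * Y ^ 3) := by
    intro m hm q' h' n' hq hh hn
    have hq' : (q' : ℝ) + 1 ≤ A := by exact_mod_cast hq
    have hh' : (h' : ℝ) + 1 ≤ B := by exact_mod_cast hh
    have hn' : (n' : ℝ) + 1 ≤ C := by exact_mod_cast hn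
    have := Ubox_bounds hD hΛ hY0 (hJ m hm) (r := r) hs hH₀ (q' := q') (h' := h') (n' := n')
      (by linarith)
    rw [hδ₁, hδ₂, hδ₃] at this
    exact this
  -- positivity of the box sizes from the hypotheses of each item
  have hApos : ∀ {q' : ℕ}, q' < A → (0 : ℝ) < A := fun h => by exact_mod_cast (by omega : 0 < A)
  have hBpos : ∀ {h' : ℕ}, h' < B → (0 : ℝ) < B := fun h => by exact_mod_cast (by omega : 0 < B)
  have hCpos : ∀ {n' : ℕ}, n' < C → (0 : ℝ) < C := fun h => by exact_mod_cast (by omega : 0 < C)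
  have hAY : (A : ℝ) ≤ Y := by
    have : (0:ℝ) ≤ B := by positivity
    have : (0:ℝ) ≤ C := by positivity
    have : (0 : ℝ) ≤ H₀ := by exact_mod_cast hH₀
    linarith [abs_nonneg (r : ℝ)]
  have hBY : (B : ℝ) ≤ Y := by
    have : (0:ℝ) ≤ A := by positivity
    have : (0:ℝ) ≤ C := by positivity
    have : (0 : ℝ) ≤ H₀ := by exact_mod_cast hH₀
    linarith [abs_nonneg (r : ℝ)]
  have hCY : (C : ℝ) ≤ Y := by
    have : (0:ℝ) ≤ A := by positivity
    have : (0:ℝ) ≤ B := by positivity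
    have : (0 : ℝ) ≤ H₀ := by exact_mod_cast hH₀
    linarith [abs_nonneg (r : ℝ)]
  -- first order: `2π K/Y ≤ Du / X` for `X ≤ Y`
  have first : ∀ X : ℝ, 0 < X → X ≤ Y → 2 * Real.pi * (K / Y) ≤ Du / X := by
    intro X hX hXY
    rw [le_div_iff₀ hX]
    have h0 : K / Y * X ≤ K := by
      rw [div_mul_eq_mul_div, div_le_iff₀ hYpos]; exact mul_le_mul_of_nonneg_left hXY hK0
    have h1 : 2 * Real.pi * (K / Y) * X ≤ 2 * Real.pi * K := by
      calc 2 * Real.pi * (K / Y) * X = 2 * Real.pi * (K / Y * X) := by ring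
        _ ≤ 2 * Real.pi * K := mul_le_mul_of_nonneg_left h0 (by positivity)
    rw [hDu]; linarith
  -- second order
  have second : ∀ X Z : ℝ, 0 < X → 0 < Z → X ≤ Y → Z ≤ Y →
      4 * Real.pi ^ 2 * (K / Y * (K / Y)) + 2 * Real.pi * (K / Y ^ 2) ≤ Du / (X * Z) := by
    intro X Z hX hZ hXY hZY
    rw [le_div_iff₀ (mul_pos hX hZ)]
    have hXZ : X * Z ≤ Y ^ 2 := by
      calc X * Z ≤ Y * Y := mul_le_mul hXY hZY hZ.le hY0
        _ = Y ^ 2 := by ring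
    have e1 : (4 * Real.pi ^ 2 * (K / Y * (K / Y)) + 2 * Real.pi * (K / Y ^ 2)) * (X * Z) =
        (4 * Real.pi ^ 2 * K ^ 2 + 2 * Real.pi * K) * ((X * Z) / Y ^ 2) := by
      field_simp
    rw [e1]
    have h3 : (X * Z) / Y ^ 2 ≤ 1 := by rw [div_le_one (by positivity)]; exact hXZ
    have h4 : 0 ≤ 4 * Real.pi ^ 2 * K ^ 2 + 2 * Real.pi * K := by positivity
    calc (4 * Real.pi ^ 2 * K ^ 2 + 2 * Real.pi * K) * ((X * Z) / Y ^ 2)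
        ≤ (4 * Real.pi ^ 2 * K ^ 2 + 2 * Real.pi * K) * 1 := mul_le_mul_of_nonneg_left h3 h4
      _ ≤ 40 * K ^ 2 + 7 * K := by linarith
      _ ≤ Du := by rw [hDu]; linarith
  have key := partialSummation₃ J A B C c (fun m q' h' n' => e (Ubox D m r s H₀ q' h' n'))
    (D := Du) (Mx := F t₀) hDu0 ?_ ?_ ?_ ?_ ?_ ?_ ?_ ?_ ?_
  · rw [hF] at key; exact key
  · -- (0) `‖φ‖ ≤ Du`
    intro m _ q' h' n' _ _ _
    rw [norm_e]; exact hDu1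
  · -- hΔ₁
    intro m hm q' h' n' hq hh hn
    obtain ⟨d1, -, -, -, -, -, -⟩ := hb m hm q' h' n' (by omega) hh (by omega)
    calc _ ≤ 2 * Real.pi * |Ubox D m r s H₀ (q' + 1) h' n' - Ubox D m r s H₀ q' h' n'| := norm_e_sub_e_le _ _
      _ ≤ 2 * Real.pi * (K / Y) := by gcongr
      _ ≤ Du / A := first A (hApos hq) hAY
  · -- hΔ₂
    intro m hm q' h' n' hq hh hn
    obtain ⟨-, d2, -, -, -, -, -⟩ := hb m hm q' h' n' hq (by omega) (by omega)
    calc _ ≤ 2 * Real.pi * |Ubox D m r s H₀ q' (h' + 1) n' - Ubox D m r s H₀ q' h' n'| := norm_e_sub_e_le _ _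
      _ ≤ 2 * Real.pi * (K / Y) := by gcongr
      _ ≤ Du / B := first B (hBpos hh) hBY
  · -- hΔ₁₂
    intro m hm q' h' n' hq hh hn
    obtain ⟨d1, d2, -, d12, -, -, -⟩ := hb m hm q' h' n' (by omega) (by omega) (by omega)
    calc _ ≤ 4 * Real.pi ^ 2 * (|Ubox D m r s H₀ (q' + 1) h' n' - Ubox D m r s H₀ q' h' n'| *
          |Ubox D m r s H₀ q' (h' + 1) n' - Ubox D m r s H₀ q' h' n'|) +
          2 * Real.pi * |Ubox D m r s H₀ (q' + 1) (h' + 1) n' - Ubox D m r s H₀ (q' + 1) h' n' -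
            Ubox D m r s H₀ q' (h' + 1) n' + Ubox D m r s H₀ q' h' n'| := norm_diff₂_e_le _ _ _ _
      _ ≤ 4 * Real.pi ^ 2 * (K / Y * (K / Y)) + 2 * Real.pi * (K / Y ^ 2) := by gcongr
      _ ≤ Du / (A * B) := second A B (hApos hq) (hBpos hh) hAY hBY
  · -- hΔ₃
    intro m hm q' h' n' hq hh hn
    obtain ⟨-, -, d3, -, -, -, -⟩ := hb m hm q' h' n' hq hh (by omega)
    calc _ ≤ 2 * Real.pi * |Ubox D m r s H₀ q' h' (n' + 1) - Ubox D m r s H₀ q' h' n'| := norm_e_sub_e_le _ _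
      _ ≤ 2 * Real.pi * (K / Y) := by gcongr
      _ ≤ Du / C := first C (hCpos hn) hCY
  · -- hΔ₁₃
    intro m hm q' h' n' hq hh hn
    obtain ⟨d1, -, d3, -, d13, -, -⟩ := hb m hm q' h' n' (by omega) hh (by omega)
    calc _ ≤ 4 * Real.pi ^ 2 * (|Ubox D m r s H₀ q' h' (n' + 1) - Ubox D m r s H₀ q' h' n'| *
          |Ubox D m r s H₀ (q' + 1) h' n' - Ubox D m r s H₀ q' h' n'|) +
          2 * Real.pi * |Ubox D m r s H₀ (q' + 1) h' (n' + 1) - Ubox D m r s H₀ q' h' (n' + 1) -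
            Ubox D m r s H₀ (q' + 1) h' n' + Ubox D m r s H₀ q' h' n'| := norm_diff₂_e_le _ _ _ _
      _ ≤ 4 * Real.pi ^ 2 * (K / Y * (K / Y)) + 2 * Real.pi * (K / Y ^ 2) := by gcongr
      _ ≤ Du / (A * C) := second A C (hApos hq) (hCpos hn) hAY hCY
  · -- hΔ₂₃
    intro m hm q' h' n' hq hh hn
    obtain ⟨-, d2, d3, -, -, d23, -⟩ := hb m hm q' h' n' hq (by omega) (by omega)
    calc _ ≤ 4 * Real.pi ^ 2 * (|Ubox D m r s H₀ q' h' (n' + 1) - Ubox D m r s H₀ q' h' n'| *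
          |Ubox D m r s H₀ q' (h' + 1) n' - Ubox D m r s H₀ q' h' n'|) +
          2 * Real.pi * |Ubox D m r s H₀ q' (h' + 1) (n' + 1) - Ubox D m r s H₀ q' h' (n' + 1) -
            Ubox D m r s H₀ q' (h' + 1) n' + Ubox D m r s H₀ q' h' n'| := norm_diff₂_e_le _ _ _ _
      _ ≤ 4 * Real.pi ^ 2 * (K / Y * (K / Y)) + 2 * Real.pi * (K / Y ^ 2) := by gcongr
      _ ≤ Du / (B * C) := second B C (hBpos hh) (hCpos hn) hBY hCY
  · -- hΔ₁₂₃
    intro m hm q' h' n' hq hh hn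
    obtain ⟨d1, d2, d3, d12, d13, d23, d123⟩ := hb m hm q' h' n' (by omega) (by omega) (by omega)
    obtain ⟨f1, f2, -, f12, -, -, -⟩ := hb m hm q' h' (n' + 1) (by omega) (by omega) (by omega)
    have hbound := norm_diff₃_e_le (Ubox D m r s H₀ q' h' n') (Ubox D m r s H₀ (q' + 1) h' n')
      (Ubox D m r s H₀ q' (h' + 1) n') (Ubox D m r s H₀ (q' + 1) (h' + 1) n') (Ubox D m r s H₀ q' h' (n' + 1))
      (Ubox D m r s H₀ (q' + 1) h' (n' + 1)) (Ubox D m r s H₀ q' (h' + 1) (n' + 1))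
      (Ubox D m r s H₀ (q' + 1) (h' + 1) (n' + 1))
    refine hbound.trans ?_
    have hABC : (0 : ℝ) < A * B * C := mul_pos (mul_pos (hApos hq) (hBpos hh)) (hCpos hn)
    -- the bounds in the syntactic shapes of `norm_diff₃_e_le`
    have hx₁₀ : |Ubox D m r s H₀ (q' + 1) h' (n' + 1) - Ubox D m r s H₀ q' h' (n' + 1) -
        (Ubox D m r s H₀ (q' + 1) h' n' - Ubox D m r s H₀ q' h' n')| ≤ K / Y ^ 2 := by
      rw [show Ubox D m r s H₀ (q' + 1) h' (n' + 1) - Ubox D m r s H₀ q' h' (n' + 1) -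
        (Ubox D m r s H₀ (q' + 1) h' n' - Ubox D m r s H₀ q' h' n') =
        Ubox D m r s H₀ (q' + 1) h' (n' + 1) - Ubox D m r s H₀ q' h' (n' + 1) -
        Ubox D m r s H₀ (q' + 1) h' n' + Ubox D m r s H₀ q' h' n' by ring]
      exact d13
    have hy₁₀ : |Ubox D m r s H₀ q' (h' + 1) (n' + 1) - Ubox D m r s H₀ q' h' (n' + 1) -
        (Ubox D m r s H₀ q' (h' + 1) n' - Ubox D m r s H₀ q' h' n')| ≤ K / Y ^ 2 := by
      rw [show Ubox D m r s H₀ q' (h' + 1) (n' + 1) - Ubox D m r s H₀ q' h' (n' + 1) -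
        (Ubox D m r s H₀ q' (h' + 1) n' - Ubox D m r s H₀ q' h' n') =
        Ubox D m r s H₀ q' (h' + 1) (n' + 1) - Ubox D m r s H₀ q' h' (n' + 1) -
        Ubox D m r s H₀ q' (h' + 1) n' + Ubox D m r s H₀ q' h' n' by ring]
      exact d23
    have hK1 : 0 ≤ K / Y := by positivity
    have hK2' : 0 ≤ K / Y ^ 2 := by positivity
    calc _ ≤ 2 * Real.pi * (K / Y) * (4 * Real.pi ^ 2 * (K / Y * (K / Y)) + 2 * Real.pi * (K / Y ^ 2)) +
          4 * Real.pi ^ 2 * (K / Y ^ 2 * (K / Y)) + 4 * Real.pi ^ 2 * (K / Y * (K / Y ^ 2)) +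
          4 * Real.pi ^ 2 * ((K / Y ^ 2 + K / Y ^ 2) * (K / Y ^ 2)) + 2 * Real.pi * (K / (2 * Y ^ 3)) := by
          gcongr
      _ ≤ Du / (A * B * C) := by
          rw [le_div_iff₀ hABC]
          have hP : (A : ℝ) * B * C ≤ Y ^ 3 := by
            have := mul_le_mul (mul_le_mul hAY hBY (by positivity) hY0) hCY (by positivity) (by positivity)
            calc (A : ℝ) * B * C ≤ Y * Y * Y := this
              _ = Y ^ 3 := by ring
          have hY3 : 0 < Y ^ 3 := by positivity
          -- everything is `(poly in K)/Y³ · (ABC) ≤ poly ≤ Du`, using `1/Y⁴ ≤ 1/Y³` (as `Y ≥ 1`)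
          have t1 : 2 * Real.pi * (K / Y) * (4 * Real.pi ^ 2 * (K / Y * (K / Y)) + 2 * Real.pi * (K / Y ^ 2)) =
              (8 * Real.pi ^ 3 * K ^ 3 + 4 * Real.pi ^ 2 * K ^ 2) / Y ^ 3 := by field_simp; ring
          have t2 : 4 * Real.pi ^ 2 * (K / Y ^ 2 * (K / Y)) + 4 * Real.pi ^ 2 * (K / Y * (K / Y ^ 2)) =
              (8 * Real.pi ^ 2 * K ^ 2) / Y ^ 3 := by field_simp; ring
          have t3 : 4 * Real.pi ^ 2 * ((K / Y ^ 2 + K / Y ^ 2) * (K / Y ^ 2)) = (8 * Real.pi ^ 2 * K ^ 2) / Y ^ 4 := by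
            field_simp; ring
          have t4 : 2 * Real.pi * (K / (2 * Y ^ 3)) = (Real.pi * K) / Y ^ 3 := by field_simp
          have t3' : (8 * Real.pi ^ 2 * K ^ 2) / Y ^ 4 ≤ (8 * Real.pi ^ 2 * K ^ 2) / Y ^ 3 := by
            apply div_le_div_of_nonneg_left (by positivity) hY3
            calc Y ^ 3 = Y ^ 3 * 1 := by ring
              _ ≤ Y ^ 3 * Y := by gcongr
              _ = Y ^ 4 := by ring
          have total : 2 * Real.pi * (K / Y) * (4 * Real.pi ^ 2 * (K / Y * (K / Y)) + 2 * Real.pi * (K / Y ^ 2)) +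
              4 * Real.pi ^ 2 * (K / Y ^ 2 * (K / Y)) + 4 * Real.pi ^ 2 * (K / Y * (K / Y ^ 2)) +
              4 * Real.pi ^ 2 * ((K / Y ^ 2 + K / Y ^ 2) * (K / Y ^ 2)) + 2 * Real.pi * (K / (2 * Y ^ 3)) ≤
              (8 * Real.pi ^ 3 * K ^ 3 + 20 * Real.pi ^ 2 * K ^ 2 + Real.pi * K) / Y ^ 3 := by
            have : (8 * Real.pi ^ 3 * K ^ 3 + 20 * Real.pi ^ 2 * K ^ 2 + Real.pi * K) / Y ^ 3 =
                (8 * Real.pi ^ 3 * K ^ 3 + 4 * Real.pi ^ 2 * K ^ 2) / Y ^ 3 + (8 * Real.pi ^ 2 * K ^ 2) / Y ^ 3 +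
                  (8 * Real.pi ^ 2 * K ^ 2) / Y ^ 3 + (Real.pi * K) / Y ^ 3 := by
              field_simp; ring
            rw [this]; linarith [t1, t2, t3, t4, t3']
          refine le_trans (mul_le_mul_of_nonneg_right total hABC.le) ?_
          rw [div_mul_eq_mul_div, div_le_iff₀ hY3]
          have hpoly : 8 * Real.pi ^ 3 * K ^ 3 + 20 * Real.pi ^ 2 * K ^ 2 + Real.pi * K ≤ Du := by
            rw [hDu]
            have h20 : 20 * Real.pi ^ 2 * K ^ 2 ≤ 200 * K ^ 2 := by
              have : 20 * Real.pi ^ 2 ≤ 200 := by linarith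
              exact mul_le_mul_of_nonneg_right this hK2
            have hpK : Real.pi * K ≤ 7 * K := by
              have : Real.pi ≤ 7 := by linarith
              exact mul_le_mul_of_nonneg_right this hK0
            linarith
          have hpoly0 : 0 ≤ 8 * Real.pi ^ 3 * K ^ 3 + 20 * Real.pi ^ 2 * K ^ 2 + Real.pi * K := by positivity
          calc (8 * Real.pi ^ 3 * K ^ 3 + 20 * Real.pi ^ 2 * K ^ 2 + Real.pi * K) * (A * B * C)
              ≤ Du * Y ^ 3 := mul_le_mul hpoly hP hABC.le hDu0
            _ = Du * Y ^ 3 := rfl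
  · -- hMx
    intro A' B' C' hA' hB' hC'
    have := hmax (A', B', C') (by simp only [Finset.mem_product, Finset.mem_range]; omega)
    calc _ = F (A', B', C') := by rw [hF]
      _ ≤ F t₀ := this

end RobertSargos
end Literature.NumberTheory.LFunctions

end
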